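import Literature.Barriers.ValiantsHypothesis.MonotoneGap
import Mathlib.Data.Finsupp.Weight
import Mathlib.Algebra.Order.BigOperators.Group.Finset
import Mathlib.Algebra.Group.Pointwise.Finset.Basic
import HarnessLib

/-!
# Jerrum–Snir's lower-bound argument (J. ACM 29 (1982), §3) for monotone computations

This file formalizes §3 ("The lower bound argument") of

* [JerrumSnir1982] M. Jerrum, M. Snir, *Some exact complexity results for straight-line
  computations over semirings*, J. ACM 29 (1982) 874–897,

for the monotone computations of `MonotoneGap.lean` (plain fan-in-two `ArithCircuit`s over the
semiring `R = (ℝ≥0, +, ·)`), in a form that is robust with respect to the junk features of the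
tree's circuit model (gates computing `0`, gates of fan-in `< 2`, constant operands inside gates,
gates that are not ancestors of the output), so that no normalization of circuits is needed.

* Positivity calculus over `ℝ≥0` (JS §2.2, the homomorphism `τ : R → B` onto the Boolean
  semiring): `support (f + g) = support f ∪ support g`, `support (f * g) = support f + support g`.
* `gateVal`, `opVal`: the value of gate `j` / of an operand read by gate `j`, and their recursion.
* `parseTree gs j m` (JS §3.2): the set of pairs `(α, m_α)` — a product gate `α` together with the
  monomial `m_α` labelling it — of the parse tree of the monomial `m` at gate `j`, defined by
  well-founded recursion on `j` (at a sum gate: descend into the first operand containing `m`; at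
  a product gate: record `(j, m)`, split `m = m₁ + m₂` along the two operands and descend into the
  nonzero parts).
* `parseTree_ok` (JS Lemma 3.1 (iii) and Thm. 3.2, robust form): every `(α, m_α)` in the parse
  tree of `m ≠ 0` at gate `j` is a product gate `α ≤ j` with `0 ≠ m_α ∈ mon(α)`, `m_α ≤ m`, and
  `(m - m_α) · mon(α) ⊆ mon(j)`.
* `complSet p A` (JS §3.1, "complement"), the content weight `cw p A = 1 / (|A| · |complement|)`
  and the weight `weight p gs T` of a parse tree (JS §3.3).
* `sum_weight_subTree_le` (JS Thm. 3.3): `Σ_{m ∈ mon(p)} w(PT(ρ, m)) ≤ #⊗-gates`, by double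
  counting through the injection `(m, (α, m_α)) ↦ (m_α, m - m_α) ∈ mon(α) × complement(α)`.
* `ContentBound`, `WeightBound` and `le_weight_parseTree` (JS Thm. 3.4): under a content bound
  `δ(r, d)` for the target polynomial and a weight function `w` with `w(r) ≤ w(d) + w(r-d) + 1/δ(r,d)`,
  every parse tree of a monomial of degree `r` weighs at least `w(r)`.
* `sum_weight_le_prodCount` (JS Cor. 3.5, robust form): for a multilinear target `p`,
  `Σ_{m ∈ mon(p)} w(deg m) ≤ prodCount P` for every monotone computation `P` of `p`.

The specialization to the permanent (JS §4.3) is carried out in the sibling files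
`MonotoneGapPermanentContent.lean`, `MonotoneGapPermanentWeights.lean`, `MonotoneGapProofs.lean`.

## Design notes

* "Content" is counted as PAIRS `(m_α, m'') ∈ mon(α) × complement(α)` rather than as products
  `m_α · m''` (JS count the products); the pair count dominates the product count, it is what the
  double counting of Thm. 3.3 needs, and for the permanent the two coincide (JS §4.3 bound the
  products through the same three-set partition argument that bounds the pairs).
* The complement of a node is taken relative to its monomial SET (`complSet p A` with
  `A = mon(α)`), inside the finite universe of monomials below some monomial of `p`.
* Everything is stated for an arbitrary gate list `gs` with the hypotheses `IsFanInTwo`/`IsPlain`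
  where needed; the output operand is treated as an operand read at position `gs.length`.
-/

noncomputable section

namespace Literature.Barriers.ValiantsHypothesis

open Literature.Computability.AlgebraicComplexity MvPolynomial Finset
open ArithCircuit (Gate Operand gateValues)
open scoped NNReal Pointwise

namespace JerrumSnir

universe u v

variable {σ : Type v}

/-! ### Positivity calculus over `ℝ≥0` (JS §2.2) -/

section Positivity

variable [DecidableEq σ]

/-- Over `ℝ≥0` no cancellation occurs in a sum: `mon(f + g) = mon(f) ∪ mon(g)`.
[cite: JerrumSnir1982, §2.2 (the homomorphism τ onto B)] -/
theorem support_add_eq (f g : MvPolynomial σ ℝ≥0) : (f + g).support = f.support ∪ g.support := by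
  ext m
  simp only [mem_support_iff, coeff_add, Finset.mem_union, ne_eq]
  constructor
  · intro h
    by_contra h'
    simp only [not_or, not_not] at h'
    exact h (by rw [h'.1, h'.2, add_zero])
  · rintro (h | h) h' <;> simp_all [AddLeftCancelMonoid.add_eq_zero]

/-- Over `ℝ≥0` (no zero divisors, no cancellation): `mon(f * g) = mon(f) + mon(g)` (sumset of
exponent vectors). [cite: JerrumSnir1982, §2.2 (the homomorphism τ onto B)] -/
theorem support_mul_eq (f g : MvPolynomial σ ℝ≥0) : (f * g).support = f.support + g.support := by
  refine le_antisymm (support_mul f g) ?_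
  intro m hm
  obtain ⟨a, ha, b, hb, rfl⟩ := Finset.mem_add.1 hm
  rw [mem_support_iff, coeff_mul]
  have hmem : (a, b) ∈ Finset.antidiagonal (a + b) := Finset.mem_antidiagonal.2 rfl
  intro h0
  have hle : coeff a f * coeff b g ≤
      ∑ x ∈ Finset.antidiagonal (a + b), coeff x.1 f * coeff x.2 g :=
    Finset.single_le_sum (f := fun x : (σ →₀ ℕ) × (σ →₀ ℕ) => coeff x.1 f * coeff x.2 g)
      (fun _ _ => zero_le) hmem
  rw [h0, nonpos_iff_eq_zero, mul_eq_zero] at hle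
  rcases hle with h | h
  · exact (mem_support_iff.1 ha) h
  · exact (mem_support_iff.1 hb) h

omit [DecidableEq σ] in
/-- A nonzero scalar does not change the monomial set. [cite: JerrumSnir1982, §2.2] -/
theorem support_smul_eq {c : ℝ≥0} (hc : c ≠ 0) (f : MvPolynomial σ ℝ≥0) :
    (c • f).support = f.support := by
  ext m
  simp [mem_support_iff, hc]

omit [DecidableEq σ] in
/-- The monomials of a scalar multiple are among those of the polynomial. [folklore] -/
theorem support_smul_subset' (c : ℝ≥0) (f : MvPolynomial σ ℝ≥0) :
    (c • f).support ⊆ f.support := by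
  intro m
  simp only [mem_support_iff, coeff_smul, smul_eq_mul, ne_eq]
  intro h h'
  exact h (by rw [h', mul_zero])

/-- Monomials of a sum of a list: `m ∈ mon(Σ l) ↔ ∃ f ∈ l, m ∈ mon(f)`. [cite: JerrumSnir1982, §2.2] -/
theorem mem_support_list_sum {l : List (MvPolynomial σ ℝ≥0)} {m : σ →₀ ℕ} :
    m ∈ l.sum.support ↔ ∃ f ∈ l, m ∈ f.support := by
  induction l with
  | nil => simp
  | cons f l ih => simp [List.sum_cons, support_add_eq, ih, or_and_right, exists_or]

end Positivity

/-! ### Values of gates and operands -/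

section Semantics

variable {k : Type u} [CommSemiring k]

/-- The value of gate number `j` of the gate list `gs` (junk `0` out of range).
[cite: JerrumSnir1982, §2.2 (the result function `res`)] -/
def gateVal (gs : List (Gate k σ)) (j : ℕ) : MvPolynomial σ k :=
  (gateValues gs).getD j 0

/-- The value of the operand `u` as read by gate number `j`: variables and constants denote
themselves, a reference to gate `j'` denotes its value if `j' < j` and the junk value `0`
otherwise. [cite: JerrumSnir1982, §2.2 (the result function `res`)] -/
def opVal (gs : List (Gate k σ)) (j : ℕ) : Operand k σ → MvPolynomial σ k
  | .var i => X i
  | .const c => C c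
  | .gate j' => if j' < j then gateVal gs j' else 0

variable (gs : List (Gate k σ))

/-- Unfolding of `opVal` on a variable. [folklore] -/
@[simp] theorem opVal_var (j : ℕ) (i : σ) : opVal gs j (.var i) = X i := rfl

/-- Unfolding of `opVal` on a constant. [folklore] -/
@[simp] theorem opVal_const (j : ℕ) (c : k) : opVal gs j (.const c) = C c := rfl

/-- Unfolding of `opVal` on a gate reference. [folklore] -/
theorem opVal_gate (j j' : ℕ) :
    opVal gs j (.gate j') = if j' < j then gateVal gs j' else 0 := rfl

/-- The fold computing `gateValues` only appends. [folklore] -/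
theorem prefix_foldl_gateValues (l : List (Gate k σ)) (pre : List (MvPolynomial σ k)) :
    pre <+: l.foldl (fun vals g => vals ++ [g.eval vals]) pre := by
  induction l generalizing pre with
  | nil => exact List.prefix_rfl
  | cons g l ih => exact (List.prefix_append pre [g.eval pre]).trans (ih _)

/-- The values of a prefix of the gate list form the corresponding prefix of the values.
[folklore] -/
theorem gateValues_take {j : ℕ} (hj : j ≤ gs.length) :
    gateValues (gs.take j) = (gateValues gs).take j := by
  have h := prefix_foldl_gateValues (gs.drop j) (gateValues (gs.take j))
  rw [List.prefix_iff_eq_take, ArithCircuit.gateValues_length, List.length_take,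
    Nat.min_eq_left hj] at h
  rw [h, gateValues, gateValues, ← List.foldl_append, List.take_append_drop]

/-- The value of an in-range gate is its gate function applied to the earlier values.
[cite: JerrumSnir1982, §2.2] -/
theorem gateVal_eq_eval {j : ℕ} {g : Gate k σ} (h : gs[j]? = some g) :
    gateVal gs j = g.eval ((gateValues gs).take j) := by
  obtain ⟨hj, rfl⟩ := List.getElem?_eq_some_iff.1 h
  have htake : gs.take (j + 1) = gs.take j ++ [gs[j]] := by
    rw [List.take_add_one, List.getElem?_eq_getElem hj]; rfl
  have h1 : gateValues (gs.take (j + 1)) =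
      gateValues (gs.take j) ++ [gs[j].eval (gateValues (gs.take j))] := by
    rw [htake, ArithCircuit.gateValues_append_singleton]
  rw [gateValues_take gs hj, gateValues_take gs hj.le] at h1
  have hlen : ((gateValues gs).take j).length = j := by
    rw [List.length_take, ArithCircuit.gateValues_length, Nat.min_eq_left hj.le]
  unfold gateVal
  rw [List.getD_eq_getElem?_getD]
  have : (gateValues gs)[j]? = ((gateValues gs).take (j + 1))[j]? := by
    rw [List.getElem?_take, if_pos (Nat.lt_succ_self j)]
  rw [this, h1, List.getElem?_append_right (by omega), hlen, Nat.sub_self]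
  simp

/-- Out of range the value is the junk `0`. [folklore] -/
theorem gateVal_of_none {j : ℕ} (h : gs[j]? = none) : gateVal gs j = 0 := by
  unfold gateVal
  rw [List.getD_eq_getElem?_getD]
  have hj : gs.length ≤ j := List.getElem?_eq_none_iff.1 h
  rw [List.getElem?_eq_none_iff.2 (by rw [ArithCircuit.gateValues_length]; exact hj)]
  rfl

/-- `opVal` is the operand semantics against the earlier values. [cite: JerrumSnir1982, §2.2] -/
theorem opVal_eq_eval (j : ℕ) (u : Operand k σ) :
    opVal gs j u = u.eval ((gateValues gs).take j) := by
  cases u with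
  | var i => rfl
  | const c => rfl
  | gate j' =>
    simp only [opVal, Operand.eval, gateVal, List.getD_eq_getElem?_getD, List.getElem?_take]
    split_ifs <;> simp

/-- The value of a sum gate. [cite: JerrumSnir1982, §2.2] -/
theorem gateVal_sum {j : ℕ} {args : List (k × Operand k σ)} (h : gs[j]? = some (.sum args)) :
    gateVal gs j = (args.map fun a => a.1 • opVal gs j a.2).sum := by
  rw [gateVal_eq_eval gs h, Gate.eval]
  congr 1
  refine List.map_congr_left fun a _ => ?_
  rw [opVal_eq_eval gs]

/-- The value of a product gate. [cite: JerrumSnir1982, §2.2] -/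
theorem gateVal_prod {j : ℕ} {args : List (Operand k σ)} (h : gs[j]? = some (.prod args)) :
    gateVal gs j = (args.map fun u => opVal gs j u).prod := by
  rw [gateVal_eq_eval gs h, Gate.eval]
  congr 1
  refine List.map_congr_left fun a _ => ?_
  rw [opVal_eq_eval gs]

/-- The output of a circuit is its output operand read at position `size`.
[cite: JerrumSnir1982, §2.2] -/
theorem eval_eq_opVal (P : ArithCircuit k σ) : P.eval = opVal P.gates P.gates.length P.output := by
  rw [opVal_eq_eval P.gates, ← ArithCircuit.gateValues_length (k := k) P.gates,
    List.take_length]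
  rfl

end Semantics

/-! ### Monomial sets of gates (JS §3.1) -/

section Supports

variable [DecidableEq σ] (gs : List (Gate ℝ≥0 σ))

/-- At a sum gate every monomial comes from some operand. [cite: JerrumSnir1982, §3.2 (ii)] -/
theorem exists_mem_of_mem_support_sum {j : ℕ} {args : List (ℝ≥0 × Operand ℝ≥0 σ)}
    (h : gs[j]? = some (.sum args)) {m : σ →₀ ℕ} (hm : m ∈ (gateVal gs j).support) :
    ∃ a ∈ args, m ∈ (opVal gs j a.2).support := by
  rw [gateVal_sum gs h, mem_support_list_sum] at hm
  obtain ⟨f, hf, hmf⟩ := hm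
  obtain ⟨a, ha, rfl⟩ := List.mem_map.1 hf
  exact ⟨a, ha, support_smul_subset' _ _ hmf⟩

/-- At a plain sum gate the monomials of every operand survive. [cite: JerrumSnir1982, Lemma 3.1 (iii)] -/
theorem support_opVal_subset_sum {j : ℕ} {args : List (ℝ≥0 × Operand ℝ≥0 σ)}
    (h : gs[j]? = some (.sum args)) (hplain : ∀ a ∈ args, a.1 = 1) {a : ℝ≥0 × Operand ℝ≥0 σ}
    (ha : a ∈ args) : (opVal gs j a.2).support ⊆ (gateVal gs j).support := by
  intro m hm
  rw [gateVal_sum gs h, mem_support_list_sum]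
  refine ⟨a.1 • opVal gs j a.2, List.mem_map.2 ⟨a, ha, rfl⟩, ?_⟩
  rwa [hplain a ha, one_smul]

/-- The monomials of a binary product gate. [cite: JerrumSnir1982, Lemma 3.1 (iii)] -/
theorem support_prod_two {j : ℕ} {u v : Operand ℝ≥0 σ} (h : gs[j]? = some (.prod [u, v])) :
    (gateVal gs j).support = (opVal gs j u).support + (opVal gs j v).support := by
  rw [gateVal_prod gs h]
  simp [support_mul_eq]

omit [DecidableEq σ] in
/-- The monomials of a unary product gate. [folklore] -/
theorem support_prod_one {j : ℕ} {u : Operand ℝ≥0 σ} (h : gs[j]? = some (.prod [u])) :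
    (gateVal gs j).support = (opVal gs j u).support := by
  rw [gateVal_prod gs h]
  simp

omit [DecidableEq σ] in
/-- A nullary product gate computes `1`. [folklore] -/
theorem gateVal_prod_nil {j : ℕ} (h : gs[j]? = some (.prod [])) : gateVal gs j = 1 := by
  rw [gateVal_prod gs h]
  simp

end Supports

/-! ### Parse trees (JS §3.2) -/

section ParseTree

variable [DecidableEq σ]

/-- The admissible splits `m = m₁ + m₂` of a monomial at a binary product gate with operands
`u`, `v`: `m₁ ∈ mon(u)`, `m₂ ∈ mon(v)`. [cite: JerrumSnir1982, §3.2 (iii)] -/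
def splits (gs : List (Gate ℝ≥0 σ)) (j : ℕ) (u v : Operand ℝ≥0 σ) (m : σ →₀ ℕ) :
    Finset ((σ →₀ ℕ) × (σ →₀ ℕ)) :=
  (Finset.antidiagonal m).filter fun x => x.1 ∈ (opVal gs j u).support ∧ x.2 ∈ (opVal gs j v).support

/-- Characterization of `splits`. [folklore] -/
theorem mem_splits {gs : List (Gate ℝ≥0 σ)} {j : ℕ} {u v : Operand ℝ≥0 σ} {m : σ →₀ ℕ}
    {x : (σ →₀ ℕ) × (σ →₀ ℕ)} :
    x ∈ splits gs j u v m ↔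
      x.1 + x.2 = m ∧ x.1 ∈ (opVal gs j u).support ∧ x.2 ∈ (opVal gs j v).support := by
  simp [splits, Finset.mem_antidiagonal]

/-- Descending into an operand of gate `j`, given the parse-tree function for gates `< j`
(variables and constants are leaves; a junk reference contributes nothing). [cite: JerrumSnir1982, §3.2] -/
def subTreeWith (j : ℕ) (F : (j' : ℕ) → j' < j → (σ →₀ ℕ) → Finset (ℕ × (σ →₀ ℕ))) :
    Operand ℝ≥0 σ → (σ →₀ ℕ) → Finset (ℕ × (σ →₀ ℕ))
  | .gate j' => fun m' => if h : j' < j then F j' h m' else ∅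
  | .var _ => fun _ => ∅
  | .const _ => fun _ => ∅

/-- **The parse tree** `PT(j, m)` of the monomial `m` at gate `j` (JS §3.2), as the finite set of
pairs `(α, m_α)` of its `⊗`-nodes `α` with their labels `m_α`: at a sum gate descend into the
first operand whose value contains `m` (JS (ii): "we can make our procedure deterministic by, say,
ordering the predecessors"); at a product gate record `(j, m)`, choose a split `m = m₁ + m₂` with
`m₁ ∈ mon(u)`, `m₂ ∈ mon(v)` and descend into the nonzero parts (JS (iii), the degenerate case
`m₂ = 1` included); defined by well-founded recursion on `j`. Junk configurations (no gate, `m`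
not a monomial of the gate, fan-in `> 2`) give `∅`. [cite: JerrumSnir1982, §3.2] -/
def parseTree (gs : List (Gate ℝ≥0 σ)) : ℕ → (σ →₀ ℕ) → Finset (ℕ × (σ →₀ ℕ))
  | j, m =>
    match gs[j]? with
    | none => ∅
    | some (.sum args) =>
      match args.find? (fun a => decide (m ∈ (opVal gs j a.2).support)) with
      | none => ∅
      | some a => subTreeWith j (fun j' _ m' => parseTree gs j' m') a.2 m
    | some (.prod []) => ∅
    | some (.prod [u]) => insert (j, m) (subTreeWith j (fun j' _ m' => parseTree gs j' m') u m)
    | some (.prod [u, v]) =>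
      if h : (splits gs j u v m).Nonempty then
        insert (j, m)
          ((if h.choose.1 = 0 then ∅
            else subTreeWith j (fun j' _ m' => parseTree gs j' m') u h.choose.1) ∪
           (if h.choose.2 = 0 then ∅
            else subTreeWith j (fun j' _ m' => parseTree gs j' m') v h.choose.2))
      else ∅
    | some (.prod (_ :: _ :: _ :: _)) => ∅
  termination_by j => j

variable (gs : List (Gate ℝ≥0 σ))

/-- The parse tree below the operand `u` of gate `j`. [cite: JerrumSnir1982, §3.2] -/
def subTree (j : ℕ) : Operand ℝ≥0 σ → (σ →₀ ℕ) → Finset (ℕ × (σ →₀ ℕ)) :=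
  subTreeWith j (fun j' _ m' => parseTree gs j' m')

/-- Variables are leaves. [cite: JerrumSnir1982, §3.2 (i)] -/
@[simp] theorem subTree_var (j : ℕ) (i : σ) (m : σ →₀ ℕ) : subTree gs j (.var i) m = ∅ := rfl

/-- Constants are leaves. [cite: JerrumSnir1982, §3.2] -/
@[simp] theorem subTree_const (j : ℕ) (c : ℝ≥0) (m : σ →₀ ℕ) :
    subTree gs j (.const c) m = ∅ := rfl

/-- Descending into an earlier gate. [cite: JerrumSnir1982, §3.2] -/
theorem subTree_gate (j j' : ℕ) (m : σ →₀ ℕ) :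
    subTree gs j (.gate j') m = if j' < j then parseTree gs j' m else ∅ := by
  show (if h : j' < j then parseTree gs j' m else ∅) = _
  split_ifs <;> rfl

/-- Unfolding of `parseTree` when there is no gate. [folklore] -/
theorem parseTree_none {j : ℕ} (h : gs[j]? = none) (m : σ →₀ ℕ) : parseTree gs j m = ∅ := by
  rw [parseTree, h]

/-- Unfolding of `parseTree` at a sum gate. [cite: JerrumSnir1982, §3.2 (ii)] -/
theorem parseTree_sum {j : ℕ} {args : List (ℝ≥0 × Operand ℝ≥0 σ)}
    (h : gs[j]? = some (.sum args)) (m : σ →₀ ℕ) :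
    parseTree gs j m =
      match args.find? (fun a => decide (m ∈ (opVal gs j a.2).support)) with
      | none => ∅
      | some a => subTree gs j a.2 m := by
  rw [parseTree, h]
  rfl

/-- Unfolding of `parseTree` at a nullary product gate. [folklore] -/
theorem parseTree_prod_nil {j : ℕ} (h : gs[j]? = some (.prod [])) (m : σ →₀ ℕ) :
    parseTree gs j m = ∅ := by
  rw [parseTree, h]

/-- Unfolding of `parseTree` at a unary product gate. [cite: JerrumSnir1982, §3.2 (iii)] -/
theorem parseTree_prod_one {j : ℕ} {u : Operand ℝ≥0 σ} (h : gs[j]? = some (.prod [u]))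
    (m : σ →₀ ℕ) : parseTree gs j m = insert (j, m) (subTree gs j u m) := by
  rw [parseTree, h]
  rfl

/-- Unfolding of `parseTree` at a binary product gate. [cite: JerrumSnir1982, §3.2 (iii)] -/
theorem parseTree_prod_two {j : ℕ} {u v : Operand ℝ≥0 σ} (h : gs[j]? = some (.prod [u, v]))
    (m : σ →₀ ℕ) :
    parseTree gs j m =
      if hs : (splits gs j u v m).Nonempty then
        insert (j, m)
          ((if hs.choose.1 = 0 then ∅ else subTree gs j u hs.choose.1) ∪
           (if hs.choose.2 = 0 then ∅ else subTree gs j v hs.choose.2))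
      else ∅ := by
  rw [parseTree, h]
  rfl

/-- Unfolding of `parseTree` at a product gate of fan-in `> 2` (junk). [folklore] -/
theorem parseTree_prod_long {j : ℕ} {u v w : Operand ℝ≥0 σ} {rest : List (Operand ℝ≥0 σ)}
    (h : gs[j]? = some (.prod (u :: v :: w :: rest))) (m : σ →₀ ℕ) : parseTree gs j m = ∅ := by
  rw [parseTree, h]

/-- At a sum gate whose `find?` succeeds the parse tree is the operand's. [folklore] -/
theorem parseTree_sum_of_find {j : ℕ} {args : List (ℝ≥0 × Operand ℝ≥0 σ)}
    (h : gs[j]? = some (.sum args)) {m : σ →₀ ℕ} {a : ℝ≥0 × Operand ℝ≥0 σ}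
    (hf : args.find? (fun a => decide (m ∈ (opVal gs j a.2).support)) = some a) :
    parseTree gs j m = subTree gs j a.2 m := by
  rw [parseTree_sum gs h, hf]

/-- At a sum gate whose `find?` fails the parse tree is empty. [folklore] -/
theorem parseTree_sum_of_find_none {j : ℕ} {args : List (ℝ≥0 × Operand ℝ≥0 σ)}
    (h : gs[j]? = some (.sum args)) {m : σ →₀ ℕ}
    (hf : args.find? (fun a => decide (m ∈ (opVal gs j a.2).support)) = none) :
    parseTree gs j m = ∅ := by
  rw [parseTree_sum gs h, hf]

end ParseTree

/-! ### Conservation of monomials along parse trees (JS Lemma 3.1 (iii), Thm. 3.2) -/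

section Invariant

variable [DecidableEq σ]

/-- What a node `x = (α, m_α)` of the parse tree of the monomial `m` below a root with monomial
set `T` satisfies: `α` is a product gate, `m_α` is a nonzero monomial of `α` dividing `m`, and
multiplying the monomials of `α` by the cofactor `m - m_α` lands in `T` ("once a monomial has been
created, it must find its way into the final result"). [cite: JerrumSnir1982, Lemma 3.1 (iii) and Thm. 3.2] -/
structure NodeOK (gs : List (Gate ℝ≥0 σ)) (T : Finset (σ →₀ ℕ)) (m : σ →₀ ℕ)
    (x : ℕ × (σ →₀ ℕ)) : Prop where
  /-- the node is a product gate -/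
  isProd : ∃ args, gs[x.1]? = some (Gate.prod args)
  /-- its label is one of its monomials -/
  mem : x.2 ∈ (gateVal gs x.1).support
  /-- the label is not the unit monomial -/
  ne_zero : x.2 ≠ 0
  /-- the label divides the root monomial -/
  le : x.2 ≤ m
  /-- conservation of monomials: the cofactor times any monomial of the node is a root monomial -/
  extend : ∀ n ∈ (gateVal gs x.1).support, m - x.2 + n ∈ T

variable {gs : List (Gate ℝ≥0 σ)}

omit [DecidableEq σ] in
/-- Enlarging the root monomial set. [folklore] -/
theorem NodeOK.mono {T T' : Finset (σ →₀ ℕ)} {m : σ →₀ ℕ} {x : ℕ × (σ →₀ ℕ)} (hT : T ⊆ T')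
    (h : NodeOK gs T m x) : NodeOK gs T' m x :=
  ⟨h.isProd, h.mem, h.ne_zero, h.le, fun n hn => hT (h.extend n hn)⟩

/-- Passing through a product gate from the left factor. [cite: JerrumSnir1982, Thm. 3.2 (iii)] -/
theorem NodeOK.add_right {A B : Finset (σ →₀ ℕ)} {m₁ m₂ : σ →₀ ℕ} {x : ℕ × (σ →₀ ℕ)}
    (h : NodeOK gs A m₁ x) (hm₂ : m₂ ∈ B) : NodeOK gs (A + B) (m₁ + m₂) x := by
  refine ⟨h.isProd, h.mem, h.ne_zero, h.le.trans le_self_add, fun n hn => ?_⟩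
  rw [← tsub_add_eq_add_tsub h.le, add_right_comm]
  exact Finset.add_mem_add (h.extend n hn) hm₂

/-- Passing through a product gate from the right factor. [cite: JerrumSnir1982, Thm. 3.2 (iii)] -/
theorem NodeOK.add_left {A B : Finset (σ →₀ ℕ)} {m₁ m₂ : σ →₀ ℕ} {x : ℕ × (σ →₀ ℕ)}
    (h : NodeOK gs B m₂ x) (hm₁ : m₁ ∈ A) : NodeOK gs (A + B) (m₁ + m₂) x := by
  refine ⟨h.isProd, h.mem, h.ne_zero, h.le.trans le_add_self, fun n hn => ?_⟩
  rw [add_tsub_assoc_of_le h.le, add_assoc]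
  exact Finset.add_mem_add hm₁ (h.extend n hn)

omit [DecidableEq σ] in
/-- The root of a parse tree at a product gate is a good node. [cite: JerrumSnir1982, Thm. 3.2 (i)] -/
theorem NodeOK.root {j : ℕ} {args : List (Operand ℝ≥0 σ)} (h : gs[j]? = some (.prod args))
    {m : σ →₀ ℕ} (hm0 : m ≠ 0) (hm : m ∈ (gateVal gs j).support) :
    NodeOK gs (gateVal gs j).support m (j, m) :=
  ⟨⟨args, h⟩, hm, hm0, le_rfl, fun n hn => by rwa [tsub_self, zero_add]⟩

/-- **Conservation of monomials** (JS Lemma 3.1 (iii) / Thm. 3.2, robust form): in a plain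
circuit, every node of the parse tree of a nonzero monomial `m` of gate `j` is a good node at
an index `≤ j`. [cite: JerrumSnir1982, Lemma 3.1 (iii) and Thm. 3.2] -/
theorem parseTree_ok (hplain : ∀ g ∈ gs, IsPlainGate g) :
    ∀ j : ℕ, ∀ m : σ →₀ ℕ, m ≠ 0 → m ∈ (gateVal gs j).support →
      ∀ x ∈ parseTree gs j m, x.1 ≤ j ∧ NodeOK gs (gateVal gs j).support m x := by
  intro j
  induction j using Nat.strong_induction_on with
  | _ j ih =>
  intro m hm0 hm x hx
  -- the operand-level consequence of the induction hypothesis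
  have hop : ∀ (u : Operand ℝ≥0 σ) (m' : σ →₀ ℕ), m' ≠ 0 → m' ∈ (opVal gs j u).support →
      ∀ y ∈ subTree gs j u m', y.1 < j ∧ NodeOK gs (opVal gs j u).support m' y := by
    intro u m' hm'0 hm' y hy
    cases u with
    | var i => simp at hy
    | const c => simp at hy
    | gate j' =>
      rw [subTree_gate] at hy
      split_ifs at hy with hlt
      · rw [opVal_gate, if_pos hlt] at hm' ⊢
        obtain ⟨hle, hok⟩ := ih j' hlt m' hm'0 hm' y hy
        exact ⟨lt_of_le_of_lt hle hlt, hok⟩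
      · simp at hy
  match hg : gs[j]? with
  | none => rw [parseTree_none gs hg] at hx; simp at hx
  | some (.sum args) =>
    have hpl : ∀ a ∈ args, a.1 = 1 :=
      (isPlainGate_sum_iff args).1 (hplain _ (List.mem_of_getElem? hg))
    cases hf : args.find? (fun a => decide (m ∈ (opVal gs j a.2).support)) with
    | none =>
      exfalso
      obtain ⟨a, ha, hma⟩ := exists_mem_of_mem_support_sum gs hg hm
      have := List.find?_eq_none.1 hf a ha
      simp [hma] at this
    | some a =>
      have ha : a ∈ args := List.mem_of_find?_eq_some hf
      have hma : m ∈ (opVal gs j a.2).support := by simpa using List.find?_some hf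
      rw [parseTree_sum_of_find gs hg hf] at hx
      obtain ⟨hlt, hok⟩ := hop a.2 m hm0 hma x hx
      exact ⟨hlt.le, hok.mono (support_opVal_subset_sum gs hg hpl ha)⟩
  | some (.prod []) => rw [parseTree_prod_nil gs hg] at hx; simp at hx
  | some (.prod [u]) =>
    rw [parseTree_prod_one gs hg, Finset.mem_insert] at hx
    rcases hx with rfl | hx
    · exact ⟨le_rfl, NodeOK.root hg hm0 hm⟩
    · rw [support_prod_one gs hg] at hm ⊢
      obtain ⟨hlt, hok⟩ := hop u m hm0 hm x hx
      exact ⟨hlt.le, hok⟩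
  | some (.prod [u, v]) =>
    rw [parseTree_prod_two gs hg] at hx
    by_cases hs : (splits gs j u v m).Nonempty
    · rw [dif_pos hs, Finset.mem_insert, Finset.mem_union] at hx
      obtain ⟨hsum, h1, h2⟩ := mem_splits.1 hs.choose_spec
      rcases hx with rfl | hx | hx
      · exact ⟨le_rfl, NodeOK.root hg hm0 hm⟩
      · by_cases h0 : hs.choose.1 = 0
        · rw [if_pos h0] at hx; simp at hx
        · rw [if_neg h0] at hx
          obtain ⟨hlt, hok⟩ := hop u _ h0 h1 x hx
          refine ⟨hlt.le, ?_⟩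
          rw [support_prod_two gs hg, ← hsum]
          exact hok.add_right h2
      · by_cases h0 : hs.choose.2 = 0
        · rw [if_pos h0] at hx; simp at hx
        · rw [if_neg h0] at hx
          obtain ⟨hlt, hok⟩ := hop v _ h0 h2 x hx
          refine ⟨hlt.le, ?_⟩
          rw [support_prod_two gs hg, ← hsum]
          exact hok.add_left h1
    · rw [dif_neg hs] at hx; simp at hx
  | some (.prod (u :: v :: w :: rest)) => rw [parseTree_prod_long gs hg] at hx; simp at hx

/-- The operand-level form of `parseTree_ok`: every node of the parse tree below the operand `u`
read at position `j` is a good node at an index `< j`. [cite: JerrumSnir1982, Thm. 3.2] -/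
theorem subTree_ok (hplain : ∀ g ∈ gs, IsPlainGate g) (j : ℕ) (u : Operand ℝ≥0 σ)
    {m : σ →₀ ℕ} (hm0 : m ≠ 0) (hm : m ∈ (opVal gs j u).support) :
    ∀ x ∈ subTree gs j u m, x.1 < j ∧ NodeOK gs (opVal gs j u).support m x := by
  intro x hx
  cases u with
  | var i => simp at hx
  | const c => simp at hx
  | gate j' =>
    rw [subTree_gate] at hx
    split_ifs at hx with hlt
    · rw [opVal_gate, if_pos hlt] at hm ⊢
      obtain ⟨hle, hok⟩ := parseTree_ok hplain j' m hm0 hm x hx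
      exact ⟨lt_of_le_of_lt hle hlt, hok⟩
    · simp at hx

end Invariant

/-! ### Complements, contents and weights (JS §3.1, §3.3) -/

section Weight

variable [DecidableEq σ]

/-- The **complement** of a monomial set `A` relative to the target polynomial `p` (JS §3.1,
`complement(α) = {m'' | ∀ m' ∈ mon(α), m'' m' ∈ mon(p)}` with `A = mon(α)`), cut down to the
finite universe of monomials dividing some monomial of `p` (which contains the whole complement
as soon as `A ≠ ∅`). [cite: JerrumSnir1982, §3.1] -/
def complSet (p : MvPolynomial σ ℝ≥0) (A : Finset (σ →₀ ℕ)) : Finset (σ →₀ ℕ) :=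
  (p.support.biUnion fun q => (Finset.antidiagonal q).image Prod.fst).filter
    fun m'' => ∀ n ∈ A, m'' + n ∈ p.support

/-- Characterization of the complement. [cite: JerrumSnir1982, §3.1] -/
theorem mem_complSet {p : MvPolynomial σ ℝ≥0} {A : Finset (σ →₀ ℕ)} {m'' : σ →₀ ℕ} :
    m'' ∈ complSet p A ↔ (∃ q ∈ p.support, m'' ≤ q) ∧ ∀ n ∈ A, m'' + n ∈ p.support := by
  simp only [complSet, Finset.mem_filter, Finset.mem_biUnion, Finset.mem_image,
    Finset.mem_antidiagonal, Prod.exists]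
  constructor
  · rintro ⟨⟨q, hq, x, y, hxy, rfl⟩, h⟩
    exact ⟨⟨q, hq, hxy ▸ le_self_add⟩, h⟩
  · rintro ⟨⟨q, hq, hle⟩, h⟩
    obtain ⟨c, hc⟩ := exists_add_of_le hle
    exact ⟨⟨q, hq, m'', c, hc.symm, rfl⟩, h⟩

/-- A cofactor of a nonempty monomial set lies in its complement. [cite: JerrumSnir1982, §3.1] -/
theorem mem_complSet_of_mem {p : MvPolynomial σ ℝ≥0} {A : Finset (σ →₀ ℕ)} {m'' n₀ : σ →₀ ℕ}
    (hn₀ : n₀ ∈ A) (h : ∀ n ∈ A, m'' + n ∈ p.support) : m'' ∈ complSet p A :=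
  mem_complSet.2 ⟨⟨m'' + n₀, h n₀ hn₀, le_self_add⟩, h⟩

/-- The **content weight** `1 / |content|` of a node with monomial set `A`, the content being
counted as the pairs `mon(α) × complement(α)` (JS §3.3: `w(T) = Σ_α |content(α)|⁻¹`; junk value
`0` when the content is empty). [cite: JerrumSnir1982, §3.3] -/
def cw (p : MvPolynomial σ ℝ≥0) (A : Finset (σ →₀ ℕ)) : ℝ :=
  1 / ((A.card : ℝ) * (complSet p A).card)

/-- Content weights are nonnegative. [folklore] -/
theorem cw_nonneg (p : MvPolynomial σ ℝ≥0) (A : Finset (σ →₀ ℕ)) : 0 ≤ cw p A := by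
  unfold cw; positivity

/-- The **weight** of a set of parse-tree nodes: the sum of the content weights of its product
gates (JS §3.3, `w(T)`). [cite: JerrumSnir1982, §3.3] -/
def weight (p : MvPolynomial σ ℝ≥0) (gs : List (Gate ℝ≥0 σ)) (T : Finset (ℕ × (σ →₀ ℕ))) : ℝ :=
  ∑ x ∈ T, cw p (gateVal gs x.1).support

variable {p : MvPolynomial σ ℝ≥0} {gs : List (Gate ℝ≥0 σ)}

/-- Weights are nonnegative. [folklore] -/
theorem weight_nonneg (T : Finset (ℕ × (σ →₀ ℕ))) : 0 ≤ weight p gs T :=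
  Finset.sum_nonneg fun _ _ => cw_nonneg _ _

/-- Weights are monotone. [folklore] -/
theorem weight_mono {T T' : Finset (ℕ × (σ →₀ ℕ))} (h : T ⊆ T') : weight p gs T ≤ weight p gs T' :=
  Finset.sum_le_sum_of_subset_of_nonneg h fun _ _ _ => cw_nonneg _ _

/-- The weight of the empty tree. [folklore] -/
@[simp] theorem weight_empty : weight p gs ∅ = 0 := Finset.sum_empty

/-- Weights add over disjoint unions. [folklore] -/
theorem weight_union {T T' : Finset (ℕ × (σ →₀ ℕ))} (h : Disjoint T T') :
    weight p gs (T ∪ T') = weight p gs T + weight p gs T' :=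
  Finset.sum_union h

/-- Inserting a new node adds its content weight. [folklore] -/
theorem weight_insert {T : Finset (ℕ × (σ →₀ ℕ))} {x : ℕ × (σ →₀ ℕ)} (h : x ∉ T) :
    weight p gs (insert x T) = cw p (gateVal gs x.1).support + weight p gs T :=
  Finset.sum_insert h

/-! ### Double counting (JS Thm. 3.3) -/

/-- Gate number `i` exists and is a product gate. [folklore] -/
def isProdAt (gs : List (Gate ℝ≥0 σ)) (i : ℕ) : Bool :=
  match gs[i]? with
  | some g => isProdGate g
  | none => false

omit [DecidableEq σ] in
/-- A product gate is detected by `isProdAt`. [folklore] -/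
theorem isProdAt_of_eq {gs : List (Gate ℝ≥0 σ)} {i : ℕ} {args : List (Operand ℝ≥0 σ)}
    (h : gs[i]? = some (Gate.prod args)) : isProdAt gs i = true := by
  simp [isProdAt, h, isProdGate]

omit [DecidableEq σ] in
/-- The indices of the product gates, counted, give `prodCount`. [folklore] -/
theorem card_filter_isProdAt (gs : List (Gate ℝ≥0 σ)) :
    ((Finset.range gs.length).filter fun i => isProdAt gs i = true).card =
      gs.countP fun g => isProdGate g := by
  induction gs using List.reverseRecOn with
  | nil => simp
  | append_singleton gs g ih =>
    have heq : ((Finset.range gs.length).filter fun i => isProdAt (gs ++ [g]) i = true) =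
        ((Finset.range gs.length).filter fun i => isProdAt gs i = true) := by
      refine Finset.filter_congr fun i hi => ?_
      rw [Finset.mem_range] at hi
      simp [isProdAt, List.getElem?_append_left hi]
    have hlast : isProdAt (gs ++ [g]) gs.length = isProdGate g := by
      simp [isProdAt]
    have hnot : gs.length ∉ (Finset.range gs.length).filter fun i => isProdAt gs i = true := by simp
    rw [List.countP_append, List.length_append, List.length_singleton, Finset.range_add_one,
      Finset.filter_insert, hlast, heq]
    cases g with
    | sum args => simp [isProdGate, ih]
    | prod args =>
      rw [if_pos (show isProdGate (Gate.prod args) = true from rfl),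
        Finset.card_insert_of_notMem hnot, ih]
      simp [isProdGate]

/-- **JS Thm. 3.3 (double counting)**: the total weight of the parse trees of the monomials of the
output `p` (read through the operand `u` at position `gs.length`) is at most the number of product
gates: a product gate `α` occurs in these trees, with label `m_α`, for at most `|content(α)|`
monomials `m`, since `(m, m_α) ↦ (m_α, m - m_α) ∈ mon(α) × complement(α)` is injective.
[cite: JerrumSnir1982, Thm. 3.3] -/
theorem sum_weight_subTree_le (hplain : ∀ g ∈ gs, IsPlainGate g) (u : Operand ℝ≥0 σ)
    (hu : opVal gs gs.length u = p) (hp0 : ∀ m ∈ p.support, m ≠ 0) :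
    ∑ m ∈ p.support, weight p gs (subTree gs gs.length u m) ≤ gs.countP fun g => isProdGate g := by
  set D := p.support.sigma fun m => subTree gs gs.length u m with hD
  have h1 : ∑ m ∈ p.support, weight p gs (subTree gs gs.length u m) =
      ∑ y ∈ D, cw p (gateVal gs y.2.1).support := by
    rw [Finset.sum_sigma]; rfl
  rw [h1]
  set I := (Finset.range gs.length).filter fun i => isProdAt gs i = true with hI
  -- every node occurring is a good node
  have hok : ∀ y ∈ D, y.2.1 < gs.length ∧ NodeOK gs p.support y.1 y.2 := by
    intro y hy
    rw [Finset.mem_sigma] at hy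
    have := subTree_ok hplain gs.length u (hp0 _ hy.1) (by rw [hu]; exact hy.1) y.2 hy.2
    rwa [hu] at this
  have hmaps : ∀ y ∈ D, y.2.1 ∈ I := by
    intro y hy
    obtain ⟨hlt, hyok⟩ := hok y hy
    obtain ⟨args, hargs⟩ := hyok.isProd
    exact Finset.mem_filter.2 ⟨Finset.mem_range.2 hlt, isProdAt_of_eq hargs⟩
  rw [← Finset.sum_fiberwise_of_maps_to hmaps, ← card_filter_isProdAt gs]
  have hfib : ∀ i ∈ I,
      ∑ y ∈ D.filter (fun y => y.2.1 = i), cw p (gateVal gs y.2.1).support ≤ 1 := by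
    intro i _
    have hconst : ∑ y ∈ D.filter (fun y => y.2.1 = i), cw p (gateVal gs y.2.1).support =
        (D.filter fun y => y.2.1 = i).card * cw p (gateVal gs i).support := by
      rw [Finset.sum_congr rfl fun y hy => by rw [(Finset.mem_filter.1 hy).2], Finset.sum_const,
        nsmul_eq_mul]
    rw [hconst]
    have hcard : (D.filter fun y => y.2.1 = i).card ≤
        (gateVal gs i).support.card * (complSet p (gateVal gs i).support).card := by
      rw [← Finset.card_product]
      refine Finset.card_le_card_of_injOn (fun y => (y.2.2, y.1 - y.2.2)) ?_ ?_
      · intro y hy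
        obtain ⟨hyD, hyi⟩ := Finset.mem_filter.1 (Finset.mem_coe.1 hy)
        obtain ⟨-, hyok⟩ := hok y hyD
        rw [← hyi]
        exact Finset.mem_coe.2 (Finset.mem_product.2
          ⟨hyok.mem, mem_complSet_of_mem hyok.mem hyok.extend⟩)
      · intro y hy y' hy' heq
        obtain ⟨hyD, hyi⟩ := Finset.mem_filter.1 (Finset.mem_coe.1 hy)
        obtain ⟨hy'D, hy'i⟩ := Finset.mem_filter.1 (Finset.mem_coe.1 hy')
        obtain ⟨-, hyok⟩ := hok y hyD
        obtain ⟨-, hy'ok⟩ := hok y' hy'D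
        simp only [Prod.mk.injEq] at heq
        obtain ⟨h2, h3⟩ := heq
        have h1 : y.1 = y'.1 := by
          rw [← add_tsub_cancel_of_le hyok.le, ← add_tsub_cancel_of_le hy'ok.le, h3, h2]
        obtain ⟨m, α, mα⟩ := y
        obtain ⟨m', α', mα'⟩ := y'
        simp only at h1 h2 hyi hy'i
        subst h1 h2 hyi hy'i
        rfl
    unfold cw
    rcases Nat.eq_zero_or_pos
      ((gateVal gs i).support.card * (complSet p (gateVal gs i).support).card) with h0 | hpos
    · have : ((gateVal gs i).support.card : ℝ) * (complSet p (gateVal gs i).support).card = 0 := by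
        exact_mod_cast h0
      rw [this]; simp
    · rw [mul_one_div]
      refine div_le_one_of_le₀ ?_ (by positivity)
      exact_mod_cast hcard
  calc ∑ i ∈ I, ∑ y ∈ D.filter (fun y => y.2.1 = i), cw p (gateVal gs y.2.1).support
      ≤ ∑ i ∈ I, (1 : ℝ) := Finset.sum_le_sum hfib
    _ = (I.card : ℝ) := by simp

end Weight

/-! ### The weight lower bound (JS Thm. 3.4) and Cor. 3.5 -/

section LowerBound

variable [DecidableEq σ]

/-- **Content bound hypothesis** for the target polynomial `p` with bound function `δ(r, d)`
(JS §3.3, the function `δ(r, d) ≥ max |content(α)|` over product nodes of degree `r` with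
predecessors of degrees `d`, `r - d`; here in the three-set form used in all of JS §4): whenever
`A + B + C ⊆ mon(p)` for nonempty monomial sets, `|A| · |B| · |C| ≤ δ(deg(a + b), deg a)` for all
`a ∈ A`, `b ∈ B`. [cite: JerrumSnir1982, §3.3 and §4.3] -/
def ContentBound (p : MvPolynomial σ ℝ≥0) (δ : ℕ → ℕ → ℝ) : Prop :=
  ∀ A B C : Finset (σ →₀ ℕ), ∀ a ∈ A, ∀ b ∈ B, C.Nonempty →
    (∀ a' ∈ A, ∀ b' ∈ B, ∀ c' ∈ C, a' + b' + c' ∈ p.support) →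
      (A.card : ℝ) * B.card * C.card ≤ δ (a + b).degree a.degree

/-- **Weight recurrence hypothesis** (JS (3.3)–(3.4) "with the equalities replaced by
inequalities", up to degree `N`): `w(0), w(1) ≤ 0`, `δ > 0`, and
`w(r) ≤ w(d) + w(r - d) + 1/δ(r, d)` for `1 ≤ d < r ≤ N`. [cite: JerrumSnir1982, Thm. 3.4 and the remark after it] -/
structure WeightBound (N : ℕ) (δ : ℕ → ℕ → ℝ) (w : ℕ → ℝ) : Prop where
  /-- the unit monomial weighs nothing -/
  zero : w 0 ≤ 0
  /-- leaves weigh nothing (JS (3.3)) -/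
  one : w 1 ≤ 0
  /-- the content bound is positive in the relevant range -/
  pos : ∀ r d : ℕ, 1 ≤ d → d < r → r ≤ N → 0 < δ r d
  /-- the recurrence inequality (JS (3.4) with `≤`) -/
  recur : ∀ r d : ℕ, 1 ≤ d → d < r → r ≤ N → w r ≤ w d + w (r - d) + 1 / δ r d

variable {gs : List (Gate ℝ≥0 σ)} {p : MvPolynomial σ ℝ≥0} {N : ℕ} {δ : ℕ → ℕ → ℝ} {w : ℕ → ℝ}

/-- In a multilinear split `m = a + b`, the parse trees below the two factors are disjoint: their
labels are nonzero and divide `a`, resp. `b` (JS §3.2 (iii): "this is ensured by the linearity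
of Γ"). [cite: JerrumSnir1982, §3.2 (iii)] -/
theorem disjoint_subTree (hplain : ∀ g ∈ gs, IsPlainGate g) {j : ℕ} {u v : Operand ℝ≥0 σ}
    {a b : σ →₀ ℕ} (ha0 : a ≠ 0) (hb0 : b ≠ 0) (ha : a ∈ (opVal gs j u).support)
    (hb : b ∈ (opVal gs j v).support) (hlin : ∀ i, (a + b) i ≤ 1) :
    Disjoint (subTree gs j u a) (subTree gs j v b) := by
  rw [Finset.disjoint_left]
  intro y hyu hyv
  obtain ⟨-, hya⟩ := subTree_ok hplain j u ha0 ha y hyu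
  obtain ⟨-, hyb⟩ := subTree_ok hplain j v hb0 hb y hyv
  apply hya.ne_zero
  ext i
  have h1 := Finsupp.le_def.1 hya.le i
  have h2 := Finsupp.le_def.1 hyb.le i
  have h3 := hlin i
  rw [Finsupp.add_apply] at h3
  simp only [Finsupp.coe_zero, Pi.zero_apply]
  omega

/-- **JS Thm. 3.4 (weight lower bound), robust form.** In a plain fan-in-two circuit over `ℝ≥0`,
for a multilinear target `p` with content bound `δ` and a weight function `w` satisfying the
recurrence up to the degree `N` of `p`: every monomial `m` of gate `j` admitting a cofactor
(`m'' · mon(j) ⊆ mon(p)` for some `m''`) has a parse tree of weight at least `w(deg m)`.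
[cite: JerrumSnir1982, Thm. 3.4] -/
theorem le_weight_parseTree (hfan : ∀ g ∈ gs, g.fanIn ≤ 2) (hplain : ∀ g ∈ gs, IsPlainGate g)
    (hlin : ∀ m ∈ p.support, ∀ i, m i ≤ 1) (hN : ∀ m ∈ p.support, m.degree ≤ N)
    (hδ : ContentBound p δ) (hw : WeightBound N δ w) :
    ∀ j : ℕ, ∀ m ∈ (gateVal gs j).support,
      (∃ m'', ∀ n ∈ (gateVal gs j).support, m'' + n ∈ p.support) →
        w m.degree ≤ weight p gs (parseTree gs j m) := by
  intro j
  induction j using Nat.strong_induction_on with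
  | _ j ih =>
  intro m hm hcof
  by_cases hm0 : m = 0
  · subst hm0
    rw [map_zero]
    exact hw.zero.trans (weight_nonneg _)
  -- the operand-level consequence of the induction hypothesis
  have hop : ∀ (u : Operand ℝ≥0 σ) (m' : σ →₀ ℕ), m' ∈ (opVal gs j u).support →
      (∃ m'', ∀ n ∈ (opVal gs j u).support, m'' + n ∈ p.support) →
        w m'.degree ≤ weight p gs (subTree gs j u m') := by
    intro u m' hm' hcof'
    cases u with
    | var i =>
      rw [opVal_var, support_X, Finset.mem_singleton] at hm'
      subst hm'
      rw [Finsupp.degree_single, subTree_var, weight_empty]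
      exact hw.one
    | const c =>
      have h0 : m' = 0 := by
        rw [opVal_const, C_apply, support_monomial] at hm'
        split_ifs at hm' with hc
        · simp at hm'
        · simpa using hm'
      subst h0
      rw [map_zero, subTree_const, weight_empty]
      exact hw.zero
    | gate j' =>
      rw [subTree_gate]
      split_ifs with hlt
      · rw [opVal_gate, if_pos hlt] at hm' hcof'
        exact ih j' hlt m' hm' hcof'
      · rw [opVal_gate, if_neg hlt] at hm'
        simp at hm'
  obtain ⟨m'', hm''⟩ := hcof
  have hmm'' : m'' + m ∈ p.support := hm'' m hm
  match hg : gs[j]? with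
  | none => rw [gateVal_of_none gs hg] at hm; simp at hm
  | some (.sum args) =>
    have hpl : ∀ a ∈ args, a.1 = 1 :=
      (isPlainGate_sum_iff args).1 (hplain _ (List.mem_of_getElem? hg))
    cases hf : args.find? (fun a => decide (m ∈ (opVal gs j a.2).support)) with
    | none =>
      exfalso
      obtain ⟨a, ha, hma⟩ := exists_mem_of_mem_support_sum gs hg hm
      have := List.find?_eq_none.1 hf a ha
      simp [hma] at this
    | some a =>
      have ha : a ∈ args := List.mem_of_find?_eq_some hf
      have hma : m ∈ (opVal gs j a.2).support := by simpa using List.find?_some hf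
      rw [parseTree_sum_of_find gs hg hf]
      have hsub := support_opVal_subset_sum gs hg hpl ha
      exact hop a.2 m hma ⟨m'', fun n hn => hm'' n (hsub hn)⟩
  | some (.prod []) =>
    exfalso
    rw [gateVal_prod_nil gs hg, support_one, Finset.mem_singleton] at hm
    exact hm0 hm
  | some (.prod [u]) =>
    rw [parseTree_prod_one gs hg]
    refine le_trans ?_ (weight_mono (Finset.subset_insert _ _))
    rw [support_prod_one gs hg] at hm hm''
    exact hop u m hm ⟨m'', hm''⟩
  | some (.prod [u, v]) =>
    rw [parseTree_prod_two gs hg]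
    have hS := support_prod_two gs hg
    have hs : (splits gs j u v m).Nonempty := by
      rw [hS] at hm
      obtain ⟨a, ha, b, hb, hab⟩ := Finset.mem_add.1 hm
      exact ⟨(a, b), mem_splits.2 ⟨hab, ha, hb⟩⟩
    rw [dif_pos hs]
    obtain ⟨hsum, h1, h2⟩ := mem_splits.1 hs.choose_spec
    -- cofactors for the two factors
    have hcof1 : ∀ n ∈ (opVal gs j u).support, m'' + hs.choose.2 + n ∈ p.support := by
      intro n hn
      have := hm'' (n + hs.choose.2) (by rw [hS]; exact Finset.add_mem_add hn h2)
      rwa [add_assoc, add_comm hs.choose.2 n]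
    have hcof2 : ∀ n ∈ (opVal gs j v).support, m'' + hs.choose.1 + n ∈ p.support := by
      intro n hn
      have := hm'' (hs.choose.1 + n) (by rw [hS]; exact Finset.add_mem_add h1 hn)
      rwa [add_assoc]
    by_cases ha0 : hs.choose.1 = 0
    · -- degenerate split: `m` itself labels the right factor
      have hbm : hs.choose.2 = m := by
        have := hsum
        rwa [ha0, zero_add] at this
      rw [if_pos ha0, Finset.empty_union]
      have hb0 : hs.choose.2 ≠ 0 := fun h => hm0 (by rw [← hbm]; exact h)
      rw [if_neg hb0]
      refine le_trans ?_ (weight_mono (Finset.subset_insert _ _))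
      calc w m.degree = w (hs.choose.2).degree := by rw [hbm]
        _ ≤ _ := hop v _ h2 ⟨m'' + hs.choose.1, hcof2⟩
    by_cases hb0 : hs.choose.2 = 0
    · have ham : hs.choose.1 = m := by
        have := hsum
        rwa [hb0, add_zero] at this
      rw [if_pos hb0, Finset.union_empty, if_neg ha0]
      refine le_trans ?_ (weight_mono (Finset.subset_insert _ _))
      calc w m.degree = w (hs.choose.1).degree := by rw [ham]
        _ ≤ _ := hop u _ h1 ⟨m'' + hs.choose.2, hcof1⟩
    -- nondegenerate split
    rw [if_neg ha0, if_neg hb0]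
    have hlin' : ∀ i, (hs.choose.1 + hs.choose.2) i ≤ 1 := by
      intro i
      have := hlin _ hmm'' i
      rw [Finsupp.add_apply, ← hsum] at this
      omega
    have hdisj : Disjoint (subTree gs j u hs.choose.1) (subTree gs j v hs.choose.2) :=
      disjoint_subTree hplain ha0 hb0 h1 h2 hlin'
    have hnotin : (j, m) ∉ subTree gs j u hs.choose.1 ∪ subTree gs j v hs.choose.2 := by
      rw [Finset.mem_union, not_or]
      constructor
      · intro h
        exact lt_irrefl j (subTree_ok hplain j u ha0 h1 _ h).1
      · intro h
        exact lt_irrefl j (subTree_ok hplain j v hb0 h2 _ h).1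
    rw [weight_insert hnotin, weight_union hdisj]
    have iha := hop u _ h1 ⟨m'' + hs.choose.2, hcof1⟩
    have ihb := hop v _ h2 ⟨m'' + hs.choose.1, hcof2⟩
    -- the content bound at this node
    have hC : (complSet p (gateVal gs j).support).Nonempty := ⟨m'', mem_complSet_of_mem hm hm''⟩
    have hcb := hδ (opVal gs j u).support (opVal gs j v).support (complSet p (gateVal gs j).support)
      _ h1 _ h2 hC (fun a' ha' b' hb' c' hc' => by
        have := (mem_complSet.1 hc').2 (a' + b') (by rw [hS]; exact Finset.add_mem_add ha' hb')
        rwa [add_comm] at this)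
    rw [hsum] at hcb
    -- degrees
    have hda : 1 ≤ (hs.choose.1).degree :=
      Nat.one_le_iff_ne_zero.2 fun h => ha0 ((Finsupp.degree_eq_zero_iff _).1 h)
    have hdb : 1 ≤ (hs.choose.2).degree :=
      Nat.one_le_iff_ne_zero.2 fun h => hb0 ((Finsupp.degree_eq_zero_iff _).1 h)
    have hdeg : m.degree = (hs.choose.1).degree + (hs.choose.2).degree := by
      rw [← map_add, hsum]
    have hrN : m.degree ≤ N := by
      have := hN _ hmm''
      rw [map_add] at this
      omega
    have hrec := hw.recur m.degree (hs.choose.1).degree hda (by omega) hrN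
    have hpos := hw.pos m.degree (hs.choose.1).degree hda (by omega) hrN
    have hcpos : (0 : ℝ) <
        ((gateVal gs j).support.card : ℝ) * (complSet p (gateVal gs j).support).card := by
      have h1' : 0 < (gateVal gs j).support.card := Finset.card_pos.2 ⟨m, hm⟩
      have h2' : 0 < (complSet p (gateVal gs j).support).card := Finset.card_pos.2 hC
      positivity
    have hcw : 1 / δ m.degree (hs.choose.1).degree ≤ cw p (gateVal gs j).support := by
      unfold cw
      apply one_div_le_one_div_of_le hcpos
      calc ((gateVal gs j).support.card : ℝ) * (complSet p (gateVal gs j).support).card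
          ≤ ((opVal gs j u).support.card * (opVal gs j v).support.card) *
              (complSet p (gateVal gs j).support).card := by
            gcongr
            rw [hS]
            exact_mod_cast Finset.card_add_le
        _ ≤ δ m.degree (hs.choose.1).degree := hcb
    have hsub : m.degree - (hs.choose.1).degree = (hs.choose.2).degree := by omega
    rw [hsub] at hrec
    linarith
  | some (.prod (u :: v :: x :: rest)) =>
    exfalso
    have := hfan _ (List.mem_of_getElem? hg)
    simp [Gate.fanIn, Gate.args] at this

/-- The operand-level form of `le_weight_parseTree`. [cite: JerrumSnir1982, Thm. 3.4] -/
theorem le_weight_subTree (hfan : ∀ g ∈ gs, g.fanIn ≤ 2) (hplain : ∀ g ∈ gs, IsPlainGate g)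
    (hlin : ∀ m ∈ p.support, ∀ i, m i ≤ 1) (hN : ∀ m ∈ p.support, m.degree ≤ N)
    (hδ : ContentBound p δ) (hw : WeightBound N δ w) (j : ℕ) (u : Operand ℝ≥0 σ) {m : σ →₀ ℕ}
    (hm : m ∈ (opVal gs j u).support)
    (hcof : ∃ m'', ∀ n ∈ (opVal gs j u).support, m'' + n ∈ p.support) :
    w m.degree ≤ weight p gs (subTree gs j u m) := by
  cases u with
  | var i =>
    rw [opVal_var, support_X, Finset.mem_singleton] at hm
    subst hm
    rw [Finsupp.degree_single, subTree_var, weight_empty]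
    exact hw.one
  | const c =>
    have h0 : m = 0 := by
      rw [opVal_const, C_apply, support_monomial] at hm
      split_ifs at hm with hc
      · simp at hm
      · simpa using hm
    subst h0
    rw [map_zero, subTree_const, weight_empty]
    exact hw.zero
  | gate j' =>
    rw [subTree_gate]
    split_ifs with hlt
    · rw [opVal_gate, if_pos hlt] at hm hcof
      exact le_weight_parseTree hfan hplain hlin hN hδ hw j' m hm hcof
    · rw [opVal_gate, if_neg hlt] at hm
      simp at hm

/-- **JS Cor. 3.5, robust form: the lower bound on the `⊗`-count.** For a multilinear target `p`
without constant term, of degree `≤ N`, with content bound `δ` and weight function `w` satisfying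
the recurrence up to `N`: every monotone computation `P` of `p` has at least
`Σ_{m ∈ mon(p)} w(deg m)` product gates (`= |mon(p)| · w(deg p)` for homogeneous `p`).
[cite: JerrumSnir1982, Cor. 3.5] -/
theorem sum_weight_le_prodCount {P : ArithCircuit ℝ≥0 σ} (hP : IsMonotoneComputation P p)
    (hp0 : ∀ m ∈ p.support, m ≠ 0) (hlin : ∀ m ∈ p.support, ∀ i, m i ≤ 1)
    (hN : ∀ m ∈ p.support, m.degree ≤ N) (hδ : ContentBound p δ) (hw : WeightBound N δ w) :
    ∑ m ∈ p.support, w m.degree ≤ prodCount P := by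
  obtain ⟨hfan, hplain, hcomp⟩ := hP
  have hu : opVal P.gates P.gates.length P.output = p := by rw [← eval_eq_opVal]; exact hcomp
  calc ∑ m ∈ p.support, w m.degree
      ≤ ∑ m ∈ p.support, weight p P.gates (subTree P.gates P.gates.length P.output m) := by
        refine Finset.sum_le_sum fun m hm => ?_
        refine le_weight_subTree hfan hplain hlin hN hδ hw _ _ (by rw [hu]; exact hm) ⟨0, ?_⟩
        intro n hn
        rw [zero_add, ← hu]
        exact hn
    _ ≤ (P.gates.countP fun g => isProdGate g : ℕ) := sum_weight_subTree_le hplain _ hu hp0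
    _ = prodCount P := rfl

end LowerBound

end JerrumSnir

end Literature.Barriers.ValiantsHypothesis
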